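import Summits.QuantumFields.BalabanUV.Beta.GAN24.DerivativeRateTransferJensenMassFreeExpTaylor
import Mathlib.Analysis.Calculus.InverseFunctionTheorem.ApproximatesLinearOn

/-!
# `BalabanUV.Beta.GAN24.DerivativeRateTransferJensenMassFreeLogarithm` — binder row G-an2-4 ∕ (CONV-C), route R6 «VALUES, NOT DERIVATIVES», PART 69:
# THE SMALL LOGARITHM — in a complete normed `ℝ`-algebra every `G` with `‖G − 1‖ ≤ 1∕8` is `exp A` for a UNIQUE `A` with `‖A‖ ≤ 1∕4`, and
# `‖A‖ ≤ 2‖G − 1‖`; for a real ORTHOGONAL matrix `G` (Frobenius norm) that logarithm is SKEW.  This discharges the «`A_x` is DATA» proviso of PARTs 67 ∕ 68: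
# the Lie-algebra data of nearby transports are produced from the transports, with the spread `s ≤ 2·‖τ_xτ₀ᵀ − 1‖` (unit b2b-balaban-gan24-p3, gen 45; v1)

NOT IN PRINT; OUR PROOF (for the ROUTE; [folklore] — the exponential series (PART 67's tail technique), Mathlib's quantitative surjectivity lemma for maps
approximated by an invertible linear map `ApproximatesLinearOn.surjOn_closedBall_of_nonlinearRightInverse` (the contraction step of the inverse function
theorem, explicit radii), and an elementary left-Lipschitz bound for injectivity).  HONEST FRAMING (cell contract, verbatim): «discharging `BetaPertH` makes
Bałaban's UV stability UNCONDITIONAL — a real constructive-QFT result; it is NOT the continuum limit and NOT the Clay problem.»  HONEST DEPENDENCY (verbatim):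
«continuum YM on T⁴ ⇐ BetaPertH ∧ nine spine estimates (0/9 proved); BetaPertH ⇐ (D1) ∧ (D4) ∧ CAP+tail; G-an2-4 gates asym, D1 and NE2/3/4.»

WHY THIS FILE.  PARTs 67 ∕ 68 compare the polar link with the exp-mean-log link `exp(Σ_x q_xA_x)·τ₀` of transports GIVEN as `τ_x = exp(A_x)·τ₀` with skew
`A_x` of size `s` — Bałaban–Jaffe's (1.28) [Erice 1985 p. 221] takes the LOGARITHMS `ln(U(Γ_x)U(yy′)⁻¹)` of the contour variables relative to the central
one, and Mathlib has no matrix logarithm.  THIS FILE supplies the small logarithm with explicit radii: (§1) in any complete normed `ℝ`-algebra,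
`‖xⁿ⁺¹ − yⁿ⁺¹‖ ≤ (n+1)ρⁿ‖x − y‖` on the ball `‖·‖ ≤ ρ`, hence **`norm_exp_sub_exp_sub_le`**: `‖exp x − exp y − (x − y)‖ ≤ 2ρ·‖x − y‖` (`ρ ≤ 1`; the tail
`Σ_{n≥2}(xⁿ − yⁿ)∕n!` against `e^ρ − 1 ≤ 2ρ`); so on the ball of radius `1∕4` the exponential is within Lipschitz constant `½` of the identity:
**`norm_sub_le_two_mul_norm_exp_sub`** (`‖x − y‖ ≤ 2‖exp x − exp y‖` — injectivity), **`norm_le_two_mul_norm_exp_sub_one`** (`‖A‖ ≤ 2‖exp A − 1‖`), and, by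
Mathlib's contraction lemma, **`exists_exp_eq_of_norm_sub_one_le`**: `‖G − 1‖ ≤ 1∕8` ⟹ `∃ A, ‖A‖ ≤ 1∕4 ∧ exp A = G` (unique there: `exp_injOn_ball`);
(§2) for real matrices in the Frobenius norm: **`exists_skew_log_of_orthogonal`** — `GᵀG = 1`, `‖G − 1‖ ≤ 1∕8` ⟹ `∃ A, Aᵀ = −A ∧ ‖A‖ ≤ 1∕4 ∧ ‖A‖ ≤ 2‖G − 1‖ ∧
exp A = G` (`Aᵀ` and `−A` are two logarithms of `Gᵀ = G⁻¹` in the ball); (§3) the transports: **`exists_skew_logs_of_transports`** — orthogonal `τ_x`, `τ₀`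
with `‖τ_x·τ₀ᵀ − 1‖ ≤ D ≤ 1∕8` ⟹ skew `A_x` with `exp(A_x)·τ₀ = τ_x`, `‖A_x‖ ≤ 2D` — the DATA of PART 68 `frob_norm_polar_sub_expMean_base_le` ∕
`transferLetter_expMean` ∕ `exists_polar_near_expMean` produced from the transports, `s = 2D`; and `frob_norm_le_sqrt_card_mul` converts the lineage's
pointwise loop letter `|(τ_xτ₀ᵀ − 1)w|² ≤ D²|w|²` into `‖τ_xτ₀ᵀ − 1‖ ≤ √(card o)·D`.

WHAT THIS FILE PROVES (0 sorry, 0 `def`, nothing cited): §1 `norm_pow_succ_sub_pow_succ_le`, **`norm_exp_sub_exp_sub_le`**, `norm_sub_le_two_mul_norm_exp_sub`,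
`exp_injOn_ball`, `norm_le_two_mul_norm_exp_sub_one`, `approximatesLinearOn_exp`, **`exists_exp_eq_of_norm_sub_one_le`**; §2 `exp_neg_eq_transpose_of_orthogonal`,
**`exists_skew_log_of_orthogonal`**; §3 `frob_norm_le_sqrt_card_mul`, **`exists_skew_logs_of_transports`**.
WHAT IT DOES NOT DO: a global logarithm, the BCH ∕ Karcher analysis, structure groups other than the full orthogonal group, anything of Bałaban's, (CONS) ∕
exact (STAB).  SUPPLIER work on route R6 (rank 2, REDUCTION, no seat); no consumer of record; NEVER «G-an2-4 closed»; NOT (CONV-C), NOT D1, NOT `BetaPertH`,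
NOT continuum, NOT Clay.  Records: `HOME/b2b-balaban-gan24-p3/WOODBURY-FIBRE.md` v14.5. -/

noncomputable section

open scoped Matrix Matrix.Norms.Frobenius NNReal
open NormedSpace Finset Matrix Metric Set

namespace Summit.QuantumFields.BalabanUV.Beta.GAN24.DerivativeRateTransferJensenMassFreeLogarithm

open Summit.QuantumFields.BalabanUV.Beta.GAN24.DerivativeRateTransferJensenMassFreePolarNear
open Summit.QuantumFields.BalabanUV.Beta.GAN24.DerivativeRateTransferJensenMassFreeExpTaylor

/-! ## §1 The small logarithm in a complete normed real algebra -/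

section Banach

variable {𝔸 : Type*} [NormedRing 𝔸] [NormedAlgebra ℝ 𝔸] [CompleteSpace 𝔸]

omit [NormedAlgebra ℝ 𝔸] [CompleteSpace 𝔸] in
/-- `‖xⁿ⁺¹ − yⁿ⁺¹‖ ≤ (n+1)·ρⁿ·‖x − y‖` for `‖x‖, ‖y‖ ≤ ρ` (noncommutative telescoping `xⁿ⁺² − yⁿ⁺² = xⁿ⁺¹(x − y) + (xⁿ⁺¹ − yⁿ⁺¹)y`). [folklore] -/
theorem norm_pow_succ_sub_pow_succ_le {x y : 𝔸} {ρ : ℝ} (hx : ‖x‖ ≤ ρ) (hy : ‖y‖ ≤ ρ) (n : ℕ) :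
    ‖x ^ (n + 1) - y ^ (n + 1)‖ ≤ (n + 1) * ρ ^ n * ‖x - y‖ := by
  have hρ : 0 ≤ ρ := (norm_nonneg x).trans hx
  induction n with
  | zero => simp
  | succ n ih =>
    have e : x ^ (n + 1 + 1) - y ^ (n + 1 + 1) = x ^ (n + 1) * (x - y) + (x ^ (n + 1) - y ^ (n + 1)) * y := by
      rw [pow_succ x (n + 1), pow_succ y (n + 1)]
      noncomm_ring
    rw [e]
    have h1 : ‖x ^ (n + 1) * (x - y)‖ ≤ ρ ^ (n + 1) * ‖x - y‖ :=
      (norm_mul_le _ _).trans (mul_le_mul_of_nonneg_right ((norm_pow_le' x (Nat.succ_pos n)).trans (pow_le_pow_left₀ (norm_nonneg x) hx _))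
        (norm_nonneg _))
    have h2 : ‖(x ^ (n + 1) - y ^ (n + 1)) * y‖ ≤ (n + 1) * ρ ^ n * ‖x - y‖ * ρ :=
      (norm_mul_le _ _).trans (mul_le_mul ih hy (norm_nonneg _) (by positivity))
    calc ‖x ^ (n + 1) * (x - y) + (x ^ (n + 1) - y ^ (n + 1)) * y‖ ≤ ρ ^ (n + 1) * ‖x - y‖ + (n + 1) * ρ ^ n * ‖x - y‖ * ρ :=
          (norm_add_le _ _).trans (add_le_add h1 h2)
      _ = (↑(n + 1) + 1) * ρ ^ (n + 1) * ‖x - y‖ := by push_cast; ring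

/-- **`norm_exp_sub_exp_sub_le` — THE EXPONENTIAL IS NEAR THE IDENTITY ON A SMALL BALL** [folklore; our proof]: in a complete normed `ℝ`-algebra, for
`‖x‖, ‖y‖ ≤ ρ ≤ 1`: `‖exp x − exp y − (x − y)‖ ≤ 2ρ·‖x − y‖` (`Σ_{n≥2}‖xⁿ − yⁿ‖∕n! ≤ Σ_{n≥2} nρⁿ⁻¹∕n!·‖x − y‖ = (e^ρ − 1)‖x − y‖ ≤ 2ρ‖x − y‖`). -/
theorem norm_exp_sub_exp_sub_le {x y : 𝔸} {ρ : ℝ} (hx : ‖x‖ ≤ ρ) (hy : ‖y‖ ≤ ρ) (hρ : ρ ≤ 1) :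
    ‖exp x - exp y - (x - y)‖ ≤ 2 * ρ * ‖x - y‖ := by
  have hρ0 : 0 ≤ ρ := (norm_nonneg x).trans hx
  have hF : HasSum (fun m => ((m.factorial : ℝ)⁻¹) • (x ^ m - y ^ m)) (exp x - exp y) := by
    have h := (NormedSpace.exp_series_hasSum_exp' (𝕂 := ℝ) x).sub (NormedSpace.exp_series_hasSum_exp' (𝕂 := ℝ) y)
    simpa only [smul_sub] using h
  have hFt : HasSum (fun m => (((m + 2).factorial : ℝ)⁻¹) • (x ^ (m + 2) - y ^ (m + 2)))
      (exp x - exp y - ∑ m ∈ range 2, ((m.factorial : ℝ)⁻¹) • (x ^ m - y ^ m)) := (hasSum_nat_add_iff' 2).mpr hF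
  have e2 : ∑ m ∈ range 2, ((m.factorial : ℝ)⁻¹) • (x ^ m - y ^ m) = x - y := by
    simp [Finset.sum_range_succ]
  rw [e2] at hFt
  have hG : HasSum (fun m => ρ ^ m / m.factorial) (Real.exp ρ) := by
    rw [congrFun Real.exp_eq_exp_ℝ ρ]
    exact NormedSpace.expSeries_div_hasSum_exp ρ
  have hGt : HasSum (fun m => ρ ^ (m + 1) / (m + 1).factorial * ‖x - y‖) ((Real.exp ρ - ∑ m ∈ range 1, ρ ^ m / m.factorial) * ‖x - y‖) :=
    ((hasSum_nat_add_iff' 1).mpr hG).mul_right _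
  have e1 : ∑ m ∈ range 1, ρ ^ m / (m.factorial : ℝ) = 1 := by simp
  rw [e1] at hGt
  have hle : ∀ m, ‖(((m + 2).factorial : ℝ)⁻¹) • (x ^ (m + 2) - y ^ (m + 2))‖ ≤ ρ ^ (m + 1) / (m + 1).factorial * ‖x - y‖ := by
    intro m
    rw [norm_smul, Real.norm_eq_abs, abs_of_pos (by positivity)]
    have h := norm_pow_succ_sub_pow_succ_le hx hy (m + 1)
    have hf : (((m + 2).factorial : ℝ)⁻¹) * ((↑(m + 1) + 1) * ρ ^ (m + 1) * ‖x - y‖) = ρ ^ (m + 1) / (m + 1).factorial * ‖x - y‖ := by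
      rw [show m + 2 = (m + 1) + 1 from rfl, Nat.factorial_succ (m + 1)]
      push_cast
      have : ((m + 1).factorial : ℝ) ≠ 0 := by positivity
      field_simp
    calc (((m + 2).factorial : ℝ)⁻¹) * ‖x ^ (m + 2) - y ^ (m + 2)‖ ≤ (((m + 2).factorial : ℝ)⁻¹) * ((↑(m + 1) + 1) * ρ ^ (m + 1) * ‖x - y‖) :=
          mul_le_mul_of_nonneg_left h (by positivity)
      _ = ρ ^ (m + 1) / (m + 1).factorial * ‖x - y‖ := hf
  have h1 := hFt.norm_le_of_bounded hGt hle
  have h2 : Real.exp ρ - 1 ≤ 2 * ρ := by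
    have h := Real.abs_exp_sub_one_le (x := ρ) (by rw [abs_of_nonneg hρ0]; exact hρ)
    rw [abs_of_nonneg hρ0] at h
    exact (le_abs_self _).trans h
  exact h1.trans (mul_le_mul_of_nonneg_right h2 (norm_nonneg _))

/-- injectivity with a constant: `‖x − y‖ ≤ 2‖exp x − exp y‖` for `‖x‖, ‖y‖ ≤ 1∕4`. [our proof] -/
theorem norm_sub_le_two_mul_norm_exp_sub {x y : 𝔸} (hx : ‖x‖ ≤ 1 / 4) (hy : ‖y‖ ≤ 1 / 4) : ‖x - y‖ ≤ 2 * ‖exp x - exp y‖ := by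
  have h := norm_exp_sub_exp_sub_le hx hy (by norm_num)
  have h2 : ‖x - y‖ ≤ ‖exp x - exp y‖ + ‖exp x - exp y - (x - y)‖ := by
    have := norm_sub_le (exp x - exp y) (exp x - exp y - (x - y))
    rwa [sub_sub_cancel] at this
  linarith

/-- the exponential is injective on the closed ball of radius `1∕4`. [our proof] -/
theorem exp_injOn_ball : InjOn (exp : 𝔸 → 𝔸) (closedBall (0 : 𝔸) (1 / 4)) := by
  intro x hx y hy hxy
  rw [mem_closedBall, dist_zero_right] at hx hy
  have h := norm_sub_le_two_mul_norm_exp_sub hx hy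
  rw [hxy, sub_self, norm_zero, mul_zero] at h
  exact sub_eq_zero.mp (norm_le_zero_iff.mp h)

/-- the a-posteriori size of a small logarithm: `‖A‖ ≤ 1∕4` ⟹ `‖A‖ ≤ 2‖exp A − 1‖`. [our proof] -/
theorem norm_le_two_mul_norm_exp_sub_one {A : 𝔸} (hA : ‖A‖ ≤ 1 / 4) : ‖A‖ ≤ 2 * ‖exp A - 1‖ := by
  have h := norm_sub_le_two_mul_norm_exp_sub hA (y := 0) (by rw [norm_zero]; norm_num)
  rwa [sub_zero, exp_zero] at h

/-- the exponential is `½`-close to the identity map on the closed ball of radius `1∕4` (Mathlib's `ApproximatesLinearOn`). [our proof] -/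
theorem approximatesLinearOn_exp :
    ApproximatesLinearOn (exp : 𝔸 → 𝔸) ((ContinuousLinearEquiv.refl ℝ 𝔸 : 𝔸 ≃L[ℝ] 𝔸) : 𝔸 →L[ℝ] 𝔸) (closedBall (0 : 𝔸) (1 / 4))
      (2 : ℝ≥0)⁻¹ := by
  intro x hx y hy
  rw [mem_closedBall, dist_zero_right] at hx hy
  have h := norm_exp_sub_exp_sub_le hx hy (by norm_num)
  simp only [ContinuousLinearEquiv.coe_coe, ContinuousLinearEquiv.refl_apply, NNReal.coe_inv, NNReal.coe_ofNat]
  linarith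

/-- **`exists_exp_eq_of_norm_sub_one_le` — THE SMALL LOGARITHM EXISTS** [folklore; our proof via Mathlib's contraction lemma]: in a complete normed
`ℝ`-algebra, `‖G − 1‖ ≤ 1∕8` ⟹ `∃ A, ‖A‖ ≤ 1∕4 ∧ exp A = G`. -/
theorem exists_exp_eq_of_norm_sub_one_le {G : 𝔸} (hG : ‖G - 1‖ ≤ 1 / 8) : ∃ A : 𝔸, ‖A‖ ≤ 1 / 4 ∧ exp A = G := by
  rcases subsingleton_or_nontrivial 𝔸 with h | h
  · exact ⟨0, by rw [norm_zero]; norm_num, Subsingleton.elim _ _⟩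
  · have hs := (approximatesLinearOn_exp (𝔸 := 𝔸)).surjOn_closedBall_of_nonlinearRightInverse
      (ContinuousLinearEquiv.refl ℝ 𝔸).toNonlinearRightInverse (ε := 1 / 4) (b := 0) (by norm_num) Subset.rfl
    have hn : ((ContinuousLinearEquiv.refl ℝ 𝔸).toNonlinearRightInverse).nnnorm = 1 := by
      show ‖((ContinuousLinearEquiv.refl ℝ 𝔸).symm : 𝔸 →L[ℝ] 𝔸)‖₊ = 1
      rw [ContinuousLinearEquiv.refl_symm, ContinuousLinearEquiv.coe_refl, ContinuousLinearMap.nnnorm_id]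
    rw [hn, exp_zero] at hs
    have hr : (((1 : ℝ≥0) : ℝ)⁻¹ - ((2 : ℝ≥0)⁻¹ : ℝ≥0)) * (1 / 4 : ℝ) = 1 / 8 := by
      rw [NNReal.coe_one, NNReal.coe_inv, NNReal.coe_ofNat]; norm_num
    have hmem : G ∈ closedBall (1 : 𝔸) ((((1 : ℝ≥0) : ℝ)⁻¹ - ((2 : ℝ≥0)⁻¹ : ℝ≥0)) * (1 / 4)) := by
      rw [mem_closedBall, dist_eq_norm, hr]
      exact hG
    obtain ⟨A, hA, hAG⟩ := hs hmem
    rw [mem_closedBall, dist_zero_right] at hA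
    exact ⟨A, hA, hAG⟩

end Banach

/-! ## §2 Real orthogonal matrices: the small logarithm is skew -/

section Orthogonal

variable {o : Type*} [Fintype o] [DecidableEq o]

/-- if `GᵀG = 1` and `exp A = G` then `exp(−A) = Gᵀ`. [folklore] -/
theorem exp_neg_eq_transpose_of_orthogonal {G A : Matrix o o ℝ} (hG : Gᵀ * G = 1) (hA : exp A = G) : exp (-A) = Gᵀ := by
  have hG' : G * Gᵀ = 1 := mul_eq_one_comm.mp hG
  have h1 : exp (-A) * exp A = 1 := by
    rw [← Matrix.exp_add_of_commute (-A) A (Commute.neg_left (Commute.refl A)), neg_add_cancel, exp_zero]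
  calc exp (-A) = exp (-A) * (G * Gᵀ) := by rw [hG', Matrix.mul_one]
    _ = (exp (-A) * exp A) * Gᵀ := by rw [hA, Matrix.mul_assoc]
    _ = Gᵀ := by rw [h1, Matrix.one_mul]

/-- **`exists_skew_log_of_orthogonal` — THE SMALL LOGARITHM OF AN ORTHOGONAL MATRIX IS SKEW** [folklore; our proof]: `GᵀG = 1`, `‖G − 1‖ ≤ 1∕8`
(Frobenius) ⟹ `∃ A, Aᵀ = −A ∧ ‖A‖ ≤ 1∕4 ∧ ‖A‖ ≤ 2‖G − 1‖ ∧ exp A = G` (both `Aᵀ` and `−A` are logarithms of `Gᵀ` in the ball where `exp` is injective). -/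
theorem exists_skew_log_of_orthogonal {G : Matrix o o ℝ} (hG : Gᵀ * G = 1) (hG1 : ‖G - 1‖ ≤ 1 / 8) :
    ∃ A : Matrix o o ℝ, Aᵀ = -A ∧ ‖A‖ ≤ 1 / 4 ∧ ‖A‖ ≤ 2 * ‖G - 1‖ ∧ exp A = G := by
  obtain ⟨A, hA, hAG⟩ := exists_exp_eq_of_norm_sub_one_le hG1
  refine ⟨A, ?_, hA, ?_, hAG⟩
  · have h1 : exp Aᵀ = Gᵀ := by rw [Matrix.exp_transpose]; exact congrArg Matrix.transpose hAG
    have h2 : exp (-A) = Gᵀ := exp_neg_eq_transpose_of_orthogonal hG hAG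
    refine exp_injOn_ball ?_ ?_ (h1.trans h2.symm)
    · rw [mem_closedBall, dist_zero_right, Matrix.frobenius_norm_transpose]; exact hA
    · rw [mem_closedBall, dist_zero_right, norm_neg]; exact hA
  · have h := norm_le_two_mul_norm_exp_sub_one hA
    rwa [hAG] at h

end Orthogonal

/-! ## §3 The Lie-algebra data of nearby transports -/

section Transports

variable {o ν : Type*} [Fintype o] [DecidableEq o]

/-- the Frobenius norm from the lineage's pointwise letter: `(∀ w, |Xw|² ≤ D²|w|²)`, `0 ≤ D` ⟹ `‖X‖ ≤ √(card o)·D` (columns `X e_j`). [folklore] -/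
theorem frob_norm_le_sqrt_card_mul {X : Matrix o o ℝ} {D : ℝ} (hD : 0 ≤ D)
    (hX : ∀ w : o → ℝ, (X *ᵥ w) ⬝ᵥ (X *ᵥ w) ≤ D ^ 2 * (w ⬝ᵥ w)) : ‖X‖ ≤ Real.sqrt (Fintype.card o) * D := by
  have hcol : ∀ j, ∑ i, X i j ^ 2 ≤ D ^ 2 := by
    intro j
    have h := hX (Pi.single j 1)
    have e1 : (X *ᵥ Pi.single j 1) ⬝ᵥ (X *ᵥ Pi.single j 1) = ∑ i, X i j ^ 2 := by
      simp only [Matrix.mulVec_single_one, dotProduct, Matrix.col_apply, sq]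
    have e2 : (Pi.single j (1 : ℝ) : o → ℝ) ⬝ᵥ Pi.single j 1 = 1 := by simp
    rw [e1, e2, mul_one] at h
    exact h
  have hsq : ‖X‖ ^ 2 ≤ (Real.sqrt (Fintype.card o) * D) ^ 2 := by
    rw [frob_norm_sq, Finset.sum_comm, mul_pow, Real.sq_sqrt (Nat.cast_nonneg _)]
    calc ∑ j, ∑ i, X i j ^ 2 ≤ ∑ _j : o, D ^ 2 := Finset.sum_le_sum fun j _ => hcol j
      _ = (Fintype.card o : ℝ) * D ^ 2 := by rw [Finset.sum_const, Finset.card_univ, nsmul_eq_mul]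
  exact (abs_le_of_sq_le_sq' hsq (by positivity)).2

/-- **`exists_skew_logs_of_transports` — THE LIE-ALGEBRA DATA OF NEARBY TRANSPORTS** [our proof]: orthogonal `τ_x` (`x : ν`) and `τ₀` with
`‖τ_x·τ₀ᵀ − 1‖ ≤ D ≤ 1∕8` (Frobenius) ⟹ ∃ skew `A_x` with `exp(A_x)·τ₀ = τ_x`, `‖A_x‖ ≤ 2D` (≤ `1∕4`) — the data of PART 68 with `s = 2D`. -/
theorem exists_skew_logs_of_transports {τ : ν → Matrix o o ℝ} {τ₀ : Matrix o o ℝ} (hτ : ∀ x, (τ x)ᵀ * τ x = 1) (hτ₀ : τ₀ᵀ * τ₀ = 1)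
    {D : ℝ} (hD : ∀ x, ‖τ x * τ₀ᵀ - 1‖ ≤ D) (hD8 : D ≤ 1 / 8) :
    ∃ A : ν → Matrix o o ℝ, (∀ x, (A x)ᵀ = -A x) ∧ (∀ x, ‖A x‖ ≤ 2 * D) ∧ (∀ x, ‖A x‖ ≤ 1 / 4) ∧ ∀ x, exp (A x) * τ₀ = τ x := by
  have hτ₀' : τ₀ * τ₀ᵀ = 1 := mul_eq_one_comm.mp hτ₀
  have hG : ∀ x, (τ x * τ₀ᵀ)ᵀ * (τ x * τ₀ᵀ) = 1 := fun x => by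
    rw [transpose_mul, transpose_transpose, Matrix.mul_assoc, ← Matrix.mul_assoc (τ x)ᵀ, hτ x, Matrix.one_mul, hτ₀']
  have h : ∀ x, ∃ Ax : Matrix o o ℝ, Axᵀ = -Ax ∧ ‖Ax‖ ≤ 1 / 4 ∧ ‖Ax‖ ≤ 2 * ‖τ x * τ₀ᵀ - 1‖ ∧ exp Ax = τ x * τ₀ᵀ := fun x =>
    exists_skew_log_of_orthogonal (hG x) ((hD x).trans hD8)
  choose A hAt hA4 hA2 hAe using h
  refine ⟨A, hAt, fun x => (hA2 x).trans (by linarith [hD x]), hA4, fun x => ?_⟩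
  rw [hAe x, Matrix.mul_assoc, hτ₀, Matrix.mul_one]

end Transports

end Summit.QuantumFields.BalabanUV.Beta.GAN24.DerivativeRateTransferJensenMassFreeLogarithm
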